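import Mathlib
import HarnessLib
import Summits.NavierStokesRegularity.NavierStokesRegularity.Theorems.WakeRatchetMinimalViscousBlowupSupLevelBootstrap

/-!
# Route `WakeRatchet`, crux `MinimalViscousBlowup` (stmt-NavierStokesRegularity-22743) — LINE g12-2 (ns-idea-1 g12, card «monotone quantity hunt»):
# THE CRITICAL SUP-LEVEL IS A ONE-SIDED LYAPUNOV FUNCTIONAL, part 2/2 — the maximum principle and NO GLOBAL LULL

ns-idea-1 g12's kernel-checked helper `lines/g12-2/SupLevelMaxPrinciple.lean` (sha16 a882c26a9cc9956b), §3–§4, landed VERBATIM by the hand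
ns-qj-p1 g7 (part 1/2 = `…SupLevelBootstrap.lean`):
* `levels_tail_lt` — high shells are uniformly small on a compact window (weight-10 bound);
* `supLevel_maxPrinciple` — regular trajectory on `[0,T)`, levels `≤ L₀` at `t₀`, `L₀ < L₁ < ν²/16384` ⇒ all levels `≤ max(L₀,128L₁^{3/2}/ν)`
  on `[t₀,T)` (REAL INDUCTION on the bootstrap `level_bootstrap`): the region {sup-level `< ν²/2¹⁴`} is forward-invariant, the sup-level
  `sup_n λⁿ‖X_n‖²` is a one-sided Lyapunov functional there;
* `noGlobalLull` — for every class table there is a STRUCTURAL `c > 0` such that along every enveloped blow-up trajectory (S4 binders VERBATIM),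
  at every instant some shell is lit: `∃ n, cν² ≤ λⁿ‖X_n(t)‖²` (quiet at `t` ⇒ quiet forever by the maximum principle ⇒ a high shell never
  fires, contradicting `everyShellFires`).  The complement of `noSustainedStall`: the cascade can stall only locally, never globally.
MODEL lattice ODEs only (Tao-type cascade, `m = 4`); nothing here concerns the Navier–Stokes equations (no NS regularity statement is proved).
`--supports stmt-NavierStokesRegularity-22743 --as helper`.
[cite: Tao2016AveragedNS, §4 (4.1)–(4.3), Lemma 4.1 (4.5), §5; BarbatoMorandinRomito2011, §3.1]
-/

noncomputable section

set_option linter.dupNamespace false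

open Set Filter Topology MeasureTheory
open Literature.Analysis.FluidPDE Literature.Analysis.FluidPDE.TaoCascade

namespace Summit.NavierStokesRegularity.NavierStokesRegularity.Theorems.MinimalViscousBlowup.ThresholdRay

/-- **High shells are uniformly small on a compact window.**  A weight-10 bound `(1+λ^{10n})|X_{i,n}| ≤ M` on `[0,T']` gives
`λ^{19m}·(λ^m‖X_m‖²) ≤ 4M²`, hence every level of the shells `m ≥ n₀(M,L)` is `< L` throughout `[0,T']`. [folklore; cf. Tao2016AveragedNS, §5] -/
theorem levels_tail_lt {ε₀ T' M L : ℝ} (hε : 0 < ε₀) (hM0 : 0 ≤ M) {X : Fin 4 → ℤ → ℝ → ℝ}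
    (hM : ∀ s, 0 ≤ s → s ≤ T' → ∀ (i : Fin 4) (n : ℤ), (1 + (1 + ε₀) ^ ((10 : ℝ) * n)) * |X i n s| ≤ M)
    (hL : 0 < L) :
    ∃ n₀ : ℕ, ∀ s, 0 ≤ s → s ≤ T' → ∀ m : ℕ, n₀ ≤ m → (1 + ε₀) ^ m * ‖shellVec X m s‖ ^ 2 < L := by
  have hl0 : (0 : ℝ) < 1 + ε₀ := by linarith
  have hl1 : (1 : ℝ) < 1 + ε₀ := by linarith
  have hdecay : ∀ s, 0 ≤ s → s ≤ T' → ∀ m : ℕ,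
      (1 + ε₀) ^ (19 * m) * ((1 + ε₀) ^ m * ‖shellVec X m s‖ ^ 2) ≤ 4 * M ^ 2 := by
    intro s hs0 hsT' m
    have hP : (0 : ℝ) < (1 + ε₀) ^ (10 * m) := pow_pos hl0 _
    have hX : ∀ i : Fin 4, |X i m s| ≤ M / (1 + ε₀) ^ (10 * m) := by
      intro i
      have h := hM s hs0 hsT' i m
      have hw : (1 + ε₀) ^ ((10 : ℝ) * ((m : ℕ) : ℤ)) = (1 + ε₀) ^ (10 * m) := by
        rw [show ((10 : ℝ) * (((m : ℕ) : ℤ) : ℝ)) = ((10 * m : ℕ) : ℝ) by push_cast; ring, Real.rpow_natCast]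
      rw [hw] at h
      rw [le_div_iff₀ hP]
      nlinarith [abs_nonneg (X i m s)]
    have hn := norm_shellVec_le_two_mul (by positivity) hX
    have hsq : ‖shellVec X m s‖ ^ 2 ≤ (2 * (M / (1 + ε₀) ^ (10 * m))) ^ 2 :=
      pow_le_pow_left₀ (norm_nonneg _) hn 2
    calc (1 + ε₀) ^ (19 * m) * ((1 + ε₀) ^ m * ‖shellVec X m s‖ ^ 2)
        ≤ (1 + ε₀) ^ (19 * m) * ((1 + ε₀) ^ m * (2 * (M / (1 + ε₀) ^ (10 * m))) ^ 2) := by gcongr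
      _ = 4 * M ^ 2 := by
          have hne : (1 + ε₀) ^ (10 * m) ≠ 0 := hP.ne'
          field_simp
          ring
  have h19 : (1 : ℝ) < (1 + ε₀) ^ 19 := one_lt_pow₀ hl1 (by norm_num)
  obtain ⟨n₀, hn₀⟩ := pow_unbounded_of_one_lt ((4 * M ^ 2 + 1) / L) h19
  refine ⟨n₀, fun s hs0 hsT' m hm => ?_⟩
  have h1 := hdecay s hs0 hsT' m
  have hpow : ((1 + ε₀) ^ 19) ^ n₀ ≤ (1 + ε₀) ^ (19 * m) := by
    rw [← pow_mul]
    exact pow_le_pow_right₀ hl1.le (by omega)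
  rw [div_lt_iff₀ hL] at hn₀
  by_contra hcon
  push Not at hcon
  have hP : 0 < (1 + ε₀) ^ (19 * m) := pow_pos hl0 _
  have h2 : (1 + ε₀) ^ (19 * m) * L ≤ (1 + ε₀) ^ (19 * m) * ((1 + ε₀) ^ m * ‖shellVec X m s‖ ^ 2) :=
    mul_le_mul_of_nonneg_left hcon hP.le
  have h3 : ((1 + ε₀) ^ 19) ^ n₀ * L ≤ (1 + ε₀) ^ (19 * m) * L := mul_le_mul_of_nonneg_right hpow hL.le
  nlinarith

/-! ### §3 The maximum principle (real induction on the bootstrap) -/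

/-- **Maximum principle for the critical sup-level.**  For a regular trajectory of the `ν`-viscous lattice on `[0,T)` (cancelling table,
`|α_{··(0,0,1)}| ≤ 1`): if at some time `t₀` every level `λⁿ‖X_n(t₀)‖²` is `≤ L₀`, then for every `L₁ ∈ (L₀, ν²/16384)` and every later
time `t < T` every level is `≤ max(L₀, 128 L₁^{3/2}/ν)` (`< L₁`).  Proof: real induction on `[t₀,t]` with the induction set "levels of the
shells `< n₀` are `≤ L₁` so far" (closed by continuity; the shells `≥ n₀` are `≤ L₁` throughout by the weight-10 bound), improved to
`≤ max(L₀,128L₁^{3/2}/ν) < L₁` by `level_bootstrap`, hence open to the right.  In particular the region {sup-level `< ν²/16384`} is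
forward-invariant and the sup-level is a one-sided Lyapunov functional there. [cite: Tao2016AveragedNS, §4 (4.1)–(4.3), §5;
BarbatoMorandinRomito2011, §3.1] -/
theorem supLevel_maxPrinciple {ε₀ ν T L₀ L₁ t₀ t : ℝ} (hε : 0 < ε₀) (hν : 0 < ν)
    {α : Fin 4 → Fin 4 → Fin 4 → ℤ × ℤ × ℤ → ℝ} (hcan : IsCancellingCoeff α)
    (hα1 : ∀ i₁ i₂ i₃, |α i₁ i₂ i₃ (0, 0, 1)| ≤ 1) {X : Fin 4 → ℤ → ℝ → ℝ}
    (hcd : ∀ i n, ContDiffOn ℝ 1 (X i n) (Ico 0 T))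
    (hlow : ∀ i n t, n < 0 → X i n t = 0)
    (hmot : ∀ i n t, 0 ≤ t → t < T → derivWithin (X i n) (Ici 0) t =
      quadTerm ε₀ α X i n t - ν * (1 + ε₀) ^ ((2 : ℝ) * n) * X i n t)
    (hreg : ∀ T' : ℝ, 0 < T' → T' < T → ∃ M : ℝ, ∀ t : ℝ, 0 ≤ t → t ≤ T' →
      ∀ (i : Fin 4) (n : ℤ), (1 + (1 + ε₀) ^ ((10 : ℝ) * n)) * |X i n t| ≤ M)
    (ht₀ : 0 ≤ t₀) (ht₀t : t₀ ≤ t) (htT : t < T)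
    (hL₀₁ : L₀ < L₁) (hL₁ : L₁ < ν ^ 2 / 16384)
    (h0 : ∀ n : ℕ, (1 + ε₀) ^ n * ‖shellVec X n t₀‖ ^ 2 ≤ L₀) :
    ∀ n : ℕ, (1 + ε₀) ^ n * ‖shellVec X n t‖ ^ 2 ≤ max L₀ (128 * L₁ * Real.sqrt L₁ / ν) := by
  have hl0 : (0 : ℝ) < 1 + ε₀ := by linarith
  have hl1 : (1 : ℝ) < 1 + ε₀ := by linarith
  have hL₀0 : 0 ≤ L₀ := le_trans (by positivity) (h0 0)
  have hL₁0 : 0 < L₁ := lt_of_le_of_lt hL₀0 hL₀₁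
  have hlow' : ∀ i n t, n < 0 → 0 ≤ t → X i n t = 0 := fun i n t hn _ => hlow i n t hn
  -- the improved level `K < L₁`
  set K : ℝ := max L₀ (128 * L₁ * Real.sqrt L₁ / ν) with hK
  have hKL₁ : K < L₁ := by
    have h2 : Real.sqrt (ν ^ 2 / 16384) = ν / 128 := by
      rw [show ν ^ 2 / 16384 = (ν / 128) ^ 2 by ring, Real.sqrt_sq (by positivity)]
    have hσ : Real.sqrt L₁ < ν / 128 := by rw [← h2]; exact Real.sqrt_lt_sqrt hL₁0.le hL₁
    have hG : 128 * L₁ * Real.sqrt L₁ / ν < L₁ := by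
      rw [div_lt_iff₀ hν]
      have := mul_lt_mul_of_pos_left hσ (by positivity : (0 : ℝ) < 128 * L₁)
      linarith
    exact max_lt hL₀₁ hG
  -- the window `[0,T']`, `T' = (t+T)/2`, its weight-10 bound and the derivative clause on it
  set T' : ℝ := (t + T) / 2 with hT'
  have hT'0 : 0 < T' := by rw [hT']; linarith
  have htT' : t < T' := by rw [hT']; linarith
  have hT'T : T' < T := by rw [hT']; linarith
  obtain ⟨M₀, hM₀⟩ := hreg T' hT'0 hT'T
  set M : ℝ := max M₀ 0 with hMdef
  have hM0 : 0 ≤ M := le_max_right _ _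
  have hM : ∀ s, 0 ≤ s → s ≤ T' → ∀ (i : Fin 4) (n : ℤ), (1 + (1 + ε₀) ^ ((10 : ℝ) * n)) * |X i n s| ≤ M :=
    fun s hs0 hsT' i n => (hM₀ s hs0 hsT' i n).trans (le_max_left _ _)
  have hder := hasDerivWithinAt_window_of_clauses (ε₀ := ε₀) (ν := ν) (α := α) hcd hmot hT'T
  clear_value K T' M
  -- tail shells are `≤ L₁` throughout `[0,T']`
  obtain ⟨n₀, hn₀⟩ := levels_tail_lt hε hM0 hM hL₁0
  have htail : ∀ s, 0 ≤ s → s ≤ T' → ∀ m : ℕ, n₀ ≤ m → (1 + ε₀) ^ m * ‖shellVec X m s‖ ^ 2 ≤ L₁ :=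
    fun s hs0 hsT' m hm => (hn₀ s hs0 hsT' m hm).le
  -- levels in the `∑ X²` form (for continuity)
  have hlev_eq : ∀ (m : ℕ) (z : ℝ), (1 + ε₀) ^ m * ‖shellVec X m z‖ ^ 2 = (1 + ε₀) ^ m * ∑ i : Fin 4, X i m z ^ 2 := by
    intro m z
    rw [norm_shellVec_sq]
  have hXc : ∀ (i : Fin 4) (k : ℤ), ContinuousOn (X i k) (Icc t₀ t) := fun i k =>
    (hcd i k).continuousOn.mono fun w hw => ⟨ht₀.trans hw.1, lt_of_le_of_lt hw.2 htT⟩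
  -- the induction set (clamped form)
  set H : Set ℝ := {y | ∀ τ ∈ Icc t₀ t, ∀ m : ℕ, m < n₀ →
      (1 + ε₀) ^ m * ‖shellVec X m (min τ y)‖ ^ 2 ≤ L₁} with hH
  have hread : ∀ y ∈ Icc t₀ t, y ∈ H → ∀ τ ∈ Icc t₀ y, ∀ m : ℕ,
      (1 + ε₀) ^ m * ‖shellVec X m τ‖ ^ 2 ≤ L₁ := by
    intro y hy hyH τ hτ m
    by_cases hm : m < n₀
    · have := hyH τ ⟨hτ.1, hτ.2.trans hy.2⟩ m hm
      rwa [min_eq_left hτ.2] at this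
    · exact htail τ (ht₀.trans hτ.1) ((hτ.2.trans hy.2).trans htT'.le) m (not_lt.1 hm)
  have himp : ∀ y ∈ Icc t₀ t, y ∈ H → ∀ τ ∈ Icc t₀ y, ∀ m : ℕ,
      (1 + ε₀) ^ m * ‖shellVec X m τ‖ ^ 2 ≤ K := by
    intro y hy hyH
    have := level_bootstrap hε hν hcan hα1 hlow' hder ht₀ (lt_of_le_of_lt hy.2 htT') hL₀₁.le hL₁ h0
      (hread y hy hyH)
    rw [← hK] at this
    exact this
  have h0H : t₀ ∈ H := by
    intro τ hτ m _
    rw [min_eq_right hτ.1]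
    exact (h0 m).trans hL₀₁.le
  have hclosed : IsClosed (H ∩ Icc t₀ t) := by
    have hlevc : ∀ τ ∈ Icc t₀ t, ∀ m : ℕ,
        ContinuousOn (fun y => (1 + ε₀) ^ m * ‖shellVec X m (min τ y)‖ ^ 2) (Icc t₀ t) := by
      intro τ hτ m
      have hmin : ContinuousOn (fun y : ℝ => min τ y) (Icc t₀ t) := (continuous_const.min continuous_id).continuousOn
      have hmaps : MapsTo (fun y : ℝ => min τ y) (Icc t₀ t) (Icc t₀ t) := fun y hy =>
        ⟨le_min hτ.1 hy.1, (min_le_right _ _).trans hy.2⟩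
      have heqf : (fun y => (1 + ε₀) ^ m * ‖shellVec X m (min τ y)‖ ^ 2) =
          fun y => (1 + ε₀) ^ m * ∑ i : Fin 4, X i m (min τ y) ^ 2 := by
        funext y
        exact hlev_eq m (min τ y)
      rw [heqf]
      exact continuousOn_const.mul (continuousOn_finsetSum _ fun i _ => ((hXc i m).comp hmin hmaps).pow 2)
    have heq : H ∩ Icc t₀ t = Icc t₀ t ∩ ⋂ τ ∈ Icc t₀ t, ⋂ m ∈ {m : ℕ | m < n₀},
        (Icc t₀ t ∩ (fun y => (1 + ε₀) ^ m * ‖shellVec X m (min τ y)‖ ^ 2) ⁻¹' Iic L₁) := by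
      ext y
      simp only [hH, mem_inter_iff, mem_iInter, mem_setOf_eq, mem_preimage, mem_Iic]
      constructor
      · rintro ⟨hyH, hy⟩
        exact ⟨hy, fun τ hτ m hm => ⟨hy, hyH τ hτ m hm⟩⟩
      · rintro ⟨hy, h⟩
        exact ⟨fun τ hτ m hm => (h τ hτ m hm).2, hy⟩
    rw [heq]
    exact isClosed_Icc.inter (isClosed_biInter fun τ hτ => isClosed_biInter fun m _ =>
      (hlevc τ hτ m).preimage_isClosed_of_isClosed isClosed_Icc isClosed_Iic)
  have hstep : ∀ y ∈ H ∩ Ico t₀ t, H ∈ 𝓝[>] y := by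
    rintro y ⟨hyH, hy⟩
    have hyI : y ∈ Icc t₀ t := Ico_subset_Icc_self hy
    have hK' := himp y hyI hyH
    have hy0 : 0 ≤ y := ht₀.trans hy.1
    have hyT : y < T := lt_of_lt_of_le hy.2 htT.le
    -- continuity of each level within `(y, T)`
    have hcw : ∀ m : ℕ, Tendsto (fun z => (1 + ε₀) ^ m * ∑ i : Fin 4, X i m z ^ 2) (𝓝[>] y)
        (𝓝 ((1 + ε₀) ^ m * ∑ i : Fin 4, X i m y ^ 2)) := by
      intro m
      have hXw : ∀ i : Fin 4, ContinuousWithinAt (X i m) (Ioi y) y := fun i =>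
        ((hcd i m).continuousOn y ⟨hy0, hyT⟩).mono_of_mem_nhdsWithin
          (mem_of_superset (Ioo_mem_nhdsGT hyT) fun z hz => ⟨hy0.trans hz.1.le, hz.2⟩)
      exact (tendsto_finsetSum _ fun i _ => ((hXw i).pow 2).tendsto).const_mul _
    have hev : ∀ᶠ z in 𝓝[>] y, ∀ m ∈ Finset.range n₀, (1 + ε₀) ^ m * ∑ i : Fin 4, X i m z ^ 2 < L₁ := by
      refine (eventually_all_finset _).2 fun m hm => ?_
      have hlt : (1 + ε₀) ^ m * ∑ i : Fin 4, X i m y ^ 2 < L₁ := by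
        rw [← hlev_eq]
        exact (hK' y ⟨hy.1, le_rfl⟩ m).trans_lt hKL₁
      exact (hcw m).eventually_lt_const hlt
    obtain ⟨u, hu, hsub⟩ := mem_nhdsGT_iff_exists_Ioo_subset.1 hev
    refine mem_of_superset (Ioo_mem_nhdsGT hu) fun z hz => ?_
    intro τ hτ m hm
    rcases le_or_gt (min τ z) y with h | h
    · have := hyH (min τ z) ⟨le_min hτ.1 (hy.1.trans hz.1.le), (min_le_left _ _).trans hτ.2⟩ m hm
      rwa [min_eq_left h] at this
    · have hmem : min τ z ∈ Ioo y u := ⟨h, lt_of_le_of_lt (min_le_right _ _) hz.2⟩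
      have := hsub hmem m (Finset.mem_range.2 hm)
      rw [hlev_eq]
      exact this.le
  have hIcc : Icc t₀ t ⊆ H := hclosed.Icc_subset_of_forall_mem_nhdsWithin h0H hstep
  intro n
  exact himp t ⟨ht₀t, le_rfl⟩ (hIcc ⟨ht₀t, le_rfl⟩) t ⟨ht₀t, le_rfl⟩ n

/-! ### §4 No global lull -/

/-- **No global lull (NGL).**  For every table of the class `E₂(R)` there is a structural `c > 0` (independent of `ν`, the datum and the
trajectory) such that along every blow-up (at `T`) of a regular trajectory of the NS-scaled `ν`-viscous cascade lattice under a critical envelope,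
AT EVERY time `t < T` SOME shell has level `λⁿ‖X_n(t)‖² ≥ cν²`.  Proof: if all levels were `< cν²` at `t` (`c = c₁/4`, `c₁ = min(c₀, 2⁻¹⁵)`,
`c₀` the firing level of `everyShellFires`), the maximum principle `supLevel_maxPrinciple` (with `L₀ = c₁ν²/4 < L₁ = c₁ν²/2 < ν²/2¹⁴`) keeps all
levels `≤ c₁ν²/4 < c₀ν²` on `[t,T)`, while on `[0,t]` the high shells are `< c₀ν²` (`levels_tail_lt`): a high shell never fires, contradicting
`everyShellFires`.  So the cascade can stall only LOCALLY, never globally — the complement of `noSustainedStall`.  MODEL lattice only.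
[cite: Tao2016AveragedNS, §4 (4.1)–(4.3), Lemma 4.1 (4.5), §5; BarbatoMorandinRomito2011, §3.1] -/
theorem noGlobalLull : ∀ ε₀ : ℝ, 0 < ε₀ → ∀ R : ℝ, 1 ≤ R →
    ∀ (α : Fin 4 → Fin 4 → Fin 4 → ℤ × ℤ × ℤ → ℝ),
    Literature.Analysis.FluidPDE.TaoCascade.InTableClass R α →
    ∃ c : ℝ, 0 < c ∧ ∀ (X₀ : Fin 4 → ℝ) (ν T C : ℝ) (X : Fin 4 → ℤ → ℝ → ℝ), 0 < ν → 0 < T →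
    (∀ i n, ContDiffOn ℝ 1 (X i n) (Set.Ico 0 T)) →
    (∀ i n, X i n 0 = if n = 0 then X₀ i else 0) →
    (∀ i n t, n < 0 → X i n t = 0) →
    (∀ i n t, 0 ≤ t → t < T → derivWithin (X i n) (Set.Ici 0) t =
      Literature.Analysis.FluidPDE.TaoCascade.quadTerm ε₀ α X i n t - ν * (1 + ε₀) ^ ((2 : ℝ) * n) * X i n t) →
    (∀ T' : ℝ, 0 < T' → T' < T → ∃ M : ℝ, ∀ t : ℝ, 0 ≤ t → t ≤ T' →
      ∀ (i : Fin 4) (n : ℤ), (1 + (1 + ε₀) ^ ((10 : ℝ) * n)) * |X i n t| ≤ M) →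
    (∀ M : ℝ, ∃ t : ℝ, 0 ≤ t ∧ t < T ∧
      ∃ (i : Fin 4) (n : ℤ), M < (1 + (1 + ε₀) ^ ((10 : ℝ) * n)) * |X i n t|) →
    (∀ (n : ℤ) (t : ℝ), 0 ≤ t → t < T →
      (1 + ε₀) ^ n * ‖Literature.Analysis.FluidPDE.TaoCascade.shellVec X n t‖ ^ 2 ≤ C) →
    ∀ t : ℝ, 0 ≤ t → t < T → ∃ n : ℕ,
      c * ν ^ 2 ≤ (1 + ε₀) ^ n * ‖Literature.Analysis.FluidPDE.TaoCascade.shellVec X n t‖ ^ 2 := by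
  intro ε₀ hε R hR α hα
  have hl0 : (0 : ℝ) < 1 + ε₀ := by linarith
  obtain ⟨c₀, hc₀0, hfire⟩ := everyShellFires ε₀ hε R hR α hα
  have hcan : IsCancellingCoeff α := hα.2.1
  have hα1 : ∀ i₁ i₂ i₃ : Fin 4, |α i₁ i₂ i₃ (0, 0, 1)| ≤ 1 := fun i₁ i₂ i₃ =>
    abs_le_one_of_inTableClass hα i₁ i₂ i₃ _ (by rw [mem_shiftSet_iff]; simp)
  set c₁ : ℝ := min c₀ (1 / 32768) with hc₁
  have hc₁0 : 0 < c₁ := lt_min hc₀0 (by norm_num)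
  have hc₁c₀ : c₁ ≤ c₀ := min_le_left _ _
  have hc₁s : c₁ ≤ 1 / 32768 := min_le_right _ _
  clear_value c₁
  refine ⟨c₁ / 4, by positivity, ?_⟩
  intro X₀ ν T C X hν hT hcd hinit hlow hmot hreg hblow henv t ht0 htT
  by_contra hcon
  push Not at hcon
  -- all levels `< c₁ν²/4` at `t`
  have h0 : ∀ n : ℕ, (1 + ε₀) ^ n * ‖shellVec X n t‖ ^ 2 ≤ c₁ / 4 * ν ^ 2 := fun n => (hcon n).le
  have hcν : 0 < c₁ * ν ^ 2 := mul_pos hc₁0 (pow_pos hν 2)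
  have hL₀₁ : c₁ / 4 * ν ^ 2 < c₁ / 2 * ν ^ 2 := by linarith
  have hL₁ : c₁ / 2 * ν ^ 2 < ν ^ 2 / 16384 := by nlinarith [sq_nonneg ν, hν]
  -- the improved level is `≤ c₁ν²/4 < c₀ν²`
  have hKlt : max (c₁ / 4 * ν ^ 2) (128 * (c₁ / 2 * ν ^ 2) * Real.sqrt (c₁ / 2 * ν ^ 2) / ν) < c₀ * ν ^ 2 := by
    have hsq : Real.sqrt (c₁ / 2 * ν ^ 2) ≤ ν / 256 := by
      have h1 : c₁ / 2 * ν ^ 2 ≤ (ν / 256) ^ 2 := by nlinarith [sq_nonneg ν]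
      calc Real.sqrt (c₁ / 2 * ν ^ 2) ≤ Real.sqrt ((ν / 256) ^ 2) := Real.sqrt_le_sqrt h1
        _ = ν / 256 := Real.sqrt_sq (by positivity)
    have hG : 128 * (c₁ / 2 * ν ^ 2) * Real.sqrt (c₁ / 2 * ν ^ 2) / ν ≤ c₁ / 4 * ν ^ 2 := by
      rw [div_le_iff₀ hν]
      have := mul_le_mul_of_nonneg_left hsq (by positivity : (0 : ℝ) ≤ 128 * (c₁ / 2 * ν ^ 2))
      nlinarith [sq_nonneg ν]
    have hL₀ : c₁ / 4 * ν ^ 2 < c₀ * ν ^ 2 := by nlinarith [sq_nonneg ν, hν]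
    exact max_lt hL₀ (lt_of_le_of_lt hG hL₀)
  -- a high shell that is small on `[0,t]`
  set T' : ℝ := (t + T) / 2 with hT'
  have hT'0 : 0 < T' := by rw [hT']; linarith
  have htT' : t < T' := by rw [hT']; linarith
  have hT'T : T' < T := by rw [hT']; linarith
  obtain ⟨M₀, hM₀⟩ := hreg T' hT'0 hT'T
  set M : ℝ := max M₀ 0 with hMdef
  have hM0 : 0 ≤ M := le_max_right _ _
  have hM : ∀ s, 0 ≤ s → s ≤ T' → ∀ (i : Fin 4) (n : ℤ), (1 + (1 + ε₀) ^ ((10 : ℝ) * n)) * |X i n s| ≤ M :=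
    fun s hs0 hsT' i n => (hM₀ s hs0 hsT' i n).trans (le_max_left _ _)
  clear_value T' M
  obtain ⟨n₀, hn₀⟩ := levels_tail_lt hε hM0 hM (by positivity : 0 < c₀ * ν ^ 2)
  -- … which nevertheless fires at some `s < T`
  obtain ⟨s, hs0, hsT, hfired⟩ := hfire X₀ ν T C X hν hT hcd hinit hlow hmot hreg hblow henv n₀ (by exact_mod_cast Nat.zero_le n₀)
  rw [zpow_natCast] at hfired
  rcases le_or_gt s t with hst | hts
  · exact absurd hfired (not_le.2 (hn₀ s hs0 (hst.trans htT'.le) n₀ le_rfl))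
  · have hmax := supLevel_maxPrinciple hε hν hcan hα1 hcd hlow hmot hreg ht0 hts.le hsT hL₀₁ hL₁ h0 n₀
    exact absurd (hfired.trans hmax) (not_le.2 hKlt)

end Summit.NavierStokesRegularity.NavierStokesRegularity.Theorems.MinimalViscousBlowup.ThresholdRay

end
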